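import Literature.NumberTheory.EllipticCurves.CongruentNumberMonskySelmerParityOdd
import Literature.NumberTheory.EllipticCurves.CongruentNumberOddMonskySelmerExact
import Literature.NumberTheory.EllipticCurves.CongruentNumberMonskySelmerRankZero
import HarnessLib

/-!
# Smith 2016, §2: the matrix `M₁ = (A + Aᵀ, Aᵀ; A, D_z)` of an odd square-free `n`, and the `2`-Selmer side of Theorem 1.2 — `#Sel⁽²⁾(E⁽ⁿ⁾/ℚ) = 4 ⟺ rank E⁽ⁿ⁾(ℚ) = 0 ∧ Ш(E⁽ⁿ⁾/ℚ)[2^∞] = 0 ⟺ det M₁ = 1` for `n ≡ 1 (mod 4)`, PROVED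

Topic `NumberTheory/EllipticCurves`, namespace `Literature.NumberTheory.EllipticCurves.Smith2016`.
A pure proof file (theorems only; Smith's `M₁` is written out as a block matrix in the tree's Monsky
vocabulary); no named fact, nothing asserted.

## The source

A. Smith, *The congruent numbers have positive natural density*, arXiv:1603.08479v2 (2016)
[Smith2016CongruentDensity], §2 "Reduction to linear algebra" (held text `paper:arxiv-1603.08479`, chunk
p0005): "we define an additive version of the Legendre symbol by `(d/p)₊ := ½(1 − (d/p))` … Write the
odd part of `n` as a product `p₁p₂⋯p_r` of odd primes. We then define a column vector `y = (y₁, …, y_r)`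
with values in `𝔽₂` by `yᵢ := (−1/pᵢ)₊` and another column vector `z` by `zᵢ := (2/pᵢ)₊`. We also define
a `r × r` matrix `A` over `𝔽₂` by `A_ij = (p_j/p_i)₊` for `i ≠ j`, `A_ii = Σ_{j ≠ i} A_ij`. For `v` any
column vector, take `D_v` to be the diagonal matrix so that `(D_v)_ii = vᵢ`" (p0005 L5–L24); proof of
Theorem 1.2 (p0005 L65–L75): "Per Monsky's calculations in [Heat94], `rk(Sel⁽²⁾(E⁽ⁿ⁾)) = 2 + crnk(M₁)`
for `n ≡ 1 (8)`".  The matrix `M₁ = M₁(A, z)` of Smith's Table 1, row `1`, is the `2r × 2r` matrix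
`(A + Aᵀ, Aᵀ; A, D_z)`: this is the shape in which it enters the expansions of §2.2 (chunk p0008 L42,
`|A + Aᵀ, Aᵀ, u; A, D_z, 0; uᵀ, 0, 0| = Σ_S det O(A, z, u)[S] · det M₁(A, z)[S′]`) and Proposition 2.4,
and it is literally MONSKY'S matrix `M₂ = (A + Aᵀ | Aᵀ ; A | D₂)` of the appendix to Heath-Brown 1994
(typescript p. 40 L19–L24), which for `D ≡ 1 (mod 4)` has the same rank as Monsky's `M` (p. 40 L1–L24:
`rank M = rank M₁ = rank M₂` when `Σ uᵢ = 0`).  (Smith's `A`, `D_v`, `(·/·)₊` ARE Monsky's `A`, `D_j`,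
additive symbols: the tree's `HeathBrown1994.legendreMatrix`, `legendreDiagonal`, `addLegendreSym`.)

## What this file proves (every `k`, no `decide` on `n`)

For `n = p₁⋯p_k` a product of distinct odd primes with `n ≡ 1 (mod 4)` and `E⁽ⁿ⁾ = congruentNumberCurve n`:

* `rank_monskyMatrixOdd_eq_rank_smithMatrixOne` — `rank M = rank M₁` (the tree's Monsky chain
  `MonskySelmerParity.rank_monskyMatrixOdd_eq` + `rank_M₁_eq_rank_M₂`, g16 of cell `bsd-monsky`);
  `monskySelmerRankOdd_eq_sub_rank_smithMatrixOne` — `s(n) = 2k − rank M₁` ("`rk Sel⁽²⁾ = 2 + crnk M₁`");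
* `det_eq_one_iff_rank_eq_card` — over `𝔽₂`, `det = 1 ⟺` full rank; hence
  **`monskySelmerRankOdd_eq_zero_iff_det_smithMatrixOne`** — `s(n) = 0 ⟺ det M₁ = 1`;
* **`card_selmerGroup_two_eq_four_iff_det_smithMatrixOne`** — `#Sel⁽²⁾(E⁽ⁿ⁾/ℚ) = 4 ⟺ det M₁ = 1`, by
  Monsky's formula WITH EQUALITY, a tree theorem (`HeathBrown1994.monsky_card_selmerGroup_two_odd_holds`);
* `card_selmerGroup_two_eq_four_of_mordellWeilRank_eq_zero_of_sha` — for every `E_N`: rank `0` and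
  `Ш[2^∞] = 0` give `#Sel₂ = 4` (Silverman X.4.2, the tree's exact descent count); with the tree's converse
  (`Smith2016.mordellWeilRank_eq_zero_of_card_selmerGroup_two`,
  `Smith2016.primaryComponent_sha_two_eq_bot_of_card_selmerGroup_two`):
  **`card_selmerGroup_two_eq_four_iff_rank_zero_and_sha`** and
  **`rank_zero_and_sha_iff_det_smithMatrixOne`** — `rank E⁽ⁿ⁾(ℚ) = 0 ∧ Ш(E⁽ⁿ⁾/ℚ)[2^∞] = 0 ⟺ det M₁ = 1`;
* `det_smithMatrixOne_eq_zero_of_mod_eight_five` — for `n ≡ 5 (mod 8)` the determinant vanishes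
  (Monsky's parity theorem: `s(n)` odd).

So the LEFT side of Smith's Theorem 1.2 / of Tian–Yuan–Zhang's (journal) Theorem 1.2 on `n ≡ 1 (mod 8)`
("`rank_ℤ E_n(ℚ) = 0` and `Ш(E_n)[2^∞] = 0`", resp. "`Sel⁽²⁾` generated by `E[2]`") is the decidable shape
`det M₁ = 1`, unconditionally; the RIGHT side (the genus sum `Σ ∏ g(dᵢ)` odd, resp. `ℒ(E⁽ⁿ⁾)` odd) is the
subject of Smith's Theorem 2.2 (`ℒ₁(n) = det M₁`), treated in the sibling files.

Cell `bsd-monsky` (prover-B g17).  AI provenance: written by an AI assistant from the held arXiv text and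
the tree; no human has reviewed it.

## References

* [Smith2016CongruentDensity] A. Smith, arXiv:1603.08479v2 (2016), §1 Conj. 1.1 / Thm. 1.2 (chunk p0003
  L9–L31), §2 (chunk p0005 L5–L75), §2.2 (chunk p0008 L42).
* [HeathBrown1994SelmerCongruentII] D. R. Heath-Brown, Invent. Math. 118 (1994) 331–370, Appendix by
  P. Monsky, typescript p. 39 L10–L33 (the matrices), p. 40 L1–L24 (`M`, `M₁`, `M₂` have the same rank
  for `D ≡ 1 (mod 4)`).
* [TianYuanZhang2017] Y. Tian, X. Yuan, S.-W. Zhang, Asian J. Math. 21 (2017), Thm. 1.2 (journal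
  numbering; = Smith, Thm. 4.1 / Cor. 4.2 as cited there).
* [SilvermanAEC2009] J. H. Silverman, *The Arithmetic of Elliptic Curves*, 2nd ed., Thm. X.4.2.
-/

open scoped Classical

open Matrix Finset
open Literature.NumberTheory.EllipticCurves.HeathBrown1994
open Literature.NumberTheory.EllipticCurves.MonskySelmerParity
open Literature.NumberTheory.EllipticCurves.CongruentNumberMonskySelmer

namespace Literature.NumberTheory.EllipticCurves.Smith2016

/-! ## §1 Smith's matrix `M₁`

Throughout, for a tuple `p : Fin k → ℕ` of odd primes, Smith's `M₁ = M₁(A, z) = (A + Aᵀ, Aᵀ; A, D_z)` is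
written out as `Matrix.fromBlocks (A + Aᵀ) Aᵀ A D₂` with `A = legendreMatrix p` (Monsky's = Smith's `A`)
and `D_z = D₂ = legendreDiagonal p 2` (Smith's `zᵢ = (2/pᵢ)₊`); no new definition is introduced (the same
expression is Monsky's `M₂` in `CongruentNumberMonskySelmerParityOdd`). -/

/-! ## §2 Linear algebra over `𝔽₂`: `det = 1 ⟺` full rank -/

/-- Over the field `𝔽₂` (whose only unit is `1`), a square matrix has determinant `1` iff it has full
rank. [cite: Smith2016CongruentDensity, §2 proof of Thm. 1.2 (chunk p0005 L65–L75: "crnk")] -/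
theorem det_eq_one_iff_rank_eq_card {m : Type*} [Fintype m] [DecidableEq m] (M : Matrix m m (ZMod 2)) :
    M.det = 1 ↔ M.rank = Fintype.card m := by
  constructor
  · exact rank_eq_card_of_det_eq_one M
  · intro h
    have hsurj : Function.Surjective M.mulVecLin := by
      rw [← LinearMap.range_eq_top]
      apply Submodule.eq_top_of_finrank_eq
      rw [Module.finrank_pi (ZMod 2), ← h, Matrix.rank]
    have hU : IsUnit M := Matrix.mulVec_surjective_iff_isUnit.mp hsurj
    have hdet : IsUnit M.det := (Matrix.isUnit_iff_isUnit_det M).mp hU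
    generalize M.det = x at hdet
    fin_cases x
    · exact absurd hdet not_isUnit_zero
    · rfl

/-- Over `𝔽₂`: `det M ≠ 1 ⟺ det M = 0`. [cite: Smith2016CongruentDensity, §2 (chunk p0005 L5–L8: values in 𝔽₂)] -/
theorem det_eq_zero_iff_ne_one {m : Type*} [Fintype m] [DecidableEq m] (M : Matrix m m (ZMod 2)) :
    M.det = 0 ↔ M.det ≠ 1 := by
  generalize M.det = x
  fin_cases x
  · exact ⟨fun _ h => zero_ne_one h, fun _ => rfl⟩
  · exact ⟨fun h => absurd h one_ne_zero, fun h => absurd rfl h⟩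

/-! ## §3 `rank M = rank M₁` and `s(n) = 2k − rank M₁` for `n ≡ 1 (mod 4)` -/

section Rank

variable {k : ℕ} (p : Fin k → ℕ)

/-- Odd primes are `≠ 2` (bookkeeping between the two hypothesis styles of the tree).
[cite: HeathBrown1994SelmerCongruentII, Appendix (Monsky), typescript p. 39 L10 ("odd square-free D")] -/
theorem ne_two_of_odd (hodd : ∀ i, Odd (p i)) : ∀ i, p i ≠ 2 := fun i h => by
  have := hodd i
  rw [h] at this
  exact (by decide : ¬ Odd 2) this

/-- **`rank M = rank M₁ + [n ≡ 3 (mod 4)]`**: Monsky's `M` (odd case) and Smith's `M₁` (= Monsky's `M₂`)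
differ in rank by `[Σ uᵢ = 1]` (typescript p. 40 L1–L24).
[cite: HeathBrown1994SelmerCongruentII, Appendix (Monsky), typescript p. 40 L1–L24]
[cite: Smith2016CongruentDensity, §2 proof of Thm. 1.2 (chunk p0005 L65–L75)] -/
theorem rank_monskyMatrixOdd_eq_rank_smithMatrixOne_add (hp : ∀ i, (p i).Prime) (hodd : ∀ i, Odd (p i))
    (hinj : Function.Injective p) :
    (monskyMatrixOdd p).rank =
      (Matrix.fromBlocks (legendreMatrix p + (legendreMatrix p)ᵀ) (legendreMatrix p)ᵀ
        (legendreMatrix p) (legendreDiagonal p 2)).rank + (if (∏ i, p i) % 4 = 1 then 0 else 1) := by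
  rw [rank_monskyMatrixOdd_eq p hp (ne_two_of_odd p hodd) hinj, rank_M₁_eq_rank_M₂]

/-- **`rank M = rank M₁` for `n ≡ 1 (mod 4)`** ("`M` and `M₁` will have the same rank, providing that
`D ≡ 1 (mod 4)`"; "`M₁` and `M₂` have the same rank").
[cite: HeathBrown1994SelmerCongruentII, Appendix (Monsky), typescript p. 40 L1–L24] -/
theorem rank_monskyMatrixOdd_eq_rank_smithMatrixOne (hp : ∀ i, (p i).Prime) (hodd : ∀ i, Odd (p i))
    (hinj : Function.Injective p) (h4 : (∏ i, p i) % 4 = 1) :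
    (monskyMatrixOdd p).rank =
      (Matrix.fromBlocks (legendreMatrix p + (legendreMatrix p)ᵀ) (legendreMatrix p)ᵀ
        (legendreMatrix p) (legendreDiagonal p 2)).rank := by
  rw [rank_monskyMatrixOdd_eq_rank_smithMatrixOne_add p hp hodd hinj, if_pos h4, add_zero]

/-- **"`rk Sel⁽²⁾(E⁽ⁿ⁾) = 2 + crnk(M₁)`"** in Monsky's normalisation: `s(n) = 2k − rank M₁` for
`n ≡ 1 (mod 4)`. [cite: Smith2016CongruentDensity, §2 proof of Thm. 1.2 (chunk p0005 L65–L69)]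
[cite: HeathBrown1994SelmerCongruentII, Appendix (Monsky), typescript p. 39 L33] -/
theorem monskySelmerRankOdd_eq_sub_rank_smithMatrixOne (hp : ∀ i, (p i).Prime) (hodd : ∀ i, Odd (p i))
    (hinj : Function.Injective p) (h4 : (∏ i, p i) % 4 = 1) :
    monskySelmerRankOdd p = 2 * k -
      (Matrix.fromBlocks (legendreMatrix p + (legendreMatrix p)ᵀ) (legendreMatrix p)ᵀ
        (legendreMatrix p) (legendreDiagonal p 2)).rank := by
  rw [monskySelmerRankOdd, rank_monskyMatrixOdd_eq_rank_smithMatrixOne p hp hodd hinj h4]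

/-- `rank M₁ ≤ 2k`. [cite: Smith2016CongruentDensity, §2 (chunk p0005 L65–L69)] -/
theorem rank_smithMatrixOne_le :
      (Matrix.fromBlocks (legendreMatrix p + (legendreMatrix p)ᵀ) (legendreMatrix p)ᵀ
        (legendreMatrix p) (legendreDiagonal p 2)).rank ≤ 2 * k := by
  have h := Matrix.rank_le_card_width
      (Matrix.fromBlocks (legendreMatrix p + (legendreMatrix p)ᵀ) (legendreMatrix p)ᵀ
        (legendreMatrix p) (legendreDiagonal p 2))
  rw [Fintype.card_sum, Fintype.card_fin] at h
  omega

/-- **`s(n) = 0 ⟺ det M₁ = 1`** for `n ≡ 1 (mod 4)`: "crnk(M₁) = 0" is the invertibility of `M₁` over `𝔽₂`.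
[cite: Smith2016CongruentDensity, §2 proof of Thm. 1.2 (chunk p0005 L65–L75)]
[cite: HeathBrown1994SelmerCongruentII, Appendix (Monsky), typescript p. 39 L33, p. 40 L1–L24] -/
theorem monskySelmerRankOdd_eq_zero_iff_det_smithMatrixOne (hp : ∀ i, (p i).Prime)
    (hodd : ∀ i, Odd (p i)) (hinj : Function.Injective p) (h4 : (∏ i, p i) % 4 = 1) :
    monskySelmerRankOdd p = 0 ↔
      (Matrix.fromBlocks (legendreMatrix p + (legendreMatrix p)ᵀ) (legendreMatrix p)ᵀ
        (legendreMatrix p) (legendreDiagonal p 2)).det = 1 := by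
  rw [monskySelmerRankOdd_eq_sub_rank_smithMatrixOne p hp hodd hinj h4, det_eq_one_iff_rank_eq_card,
    Fintype.card_sum, Fintype.card_fin]
  have h := rank_smithMatrixOne_le p
  omega

/-- **For `n ≡ 5 (mod 8)` the determinant of `M₁` vanishes**: `s(n)` is odd by Monsky's parity theorem
(tree: `odd_monskySelmerRankOdd_iff`), so `s(n) ≠ 0`.  ("If `n ≡ 5 (8)`, then the minimal possible corank
of `M₁` is one.") [cite: Smith2016CongruentDensity, §3 (chunk p0011 L63)]
[cite: HeathBrown1994SelmerCongruentII, Appendix (Monsky), Theorem, typescript p. 38 L5–L7] -/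
theorem det_smithMatrixOne_eq_zero_of_mod_eight_five (hp : ∀ i, (p i).Prime) (hodd : ∀ i, Odd (p i))
    (hinj : Function.Injective p) (h5 : (∏ i, p i) % 8 = 5) :

      (Matrix.fromBlocks (legendreMatrix p + (legendreMatrix p)ᵀ) (legendreMatrix p)ᵀ
        (legendreMatrix p) (legendreDiagonal p 2)).det = 0 := by
  have h4 : (∏ i, p i) % 4 = 1 := by omega
  rw [det_eq_zero_iff_ne_one, Ne, ← monskySelmerRankOdd_eq_zero_iff_det_smithMatrixOne p hp hodd hinj h4]
  intro h0
  have hsodd : Odd (monskySelmerRankOdd p) :=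
    (odd_monskySelmerRankOdd_iff p hp (ne_two_of_odd p hodd) hinj).mpr (Or.inl h5)
  rw [h0] at hsodd
  exact (by decide : ¬ Odd 0) hsodd

end Rank

/-! ## §4 The `2`-Selmer group: `#Sel⁽²⁾(E⁽ⁿ⁾/ℚ) = 4 ⟺ det M₁ = 1` (Monsky's formula with equality) -/

section Selmer

variable {k : ℕ} (p : Fin k → ℕ)

/-- **`#Sel⁽²⁾(E⁽ⁿ⁾/ℚ) = 2^{2 + 2k − rank M₁}`** for `n = p₁⋯p_k ≡ 1 (mod 4)`: Monsky's theorem with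
equality (a tree theorem, `monsky_card_selmerGroup_two_odd_holds`) in Smith's normalisation.
[cite: Smith2016CongruentDensity, §2 proof of Thm. 1.2 (chunk p0005 L65–L69)]
[cite: HeathBrown1994SelmerCongruentII, Appendix (Monsky), typescript p. 39 L10–L33] -/
theorem card_selmerGroup_two_eq_pow_smithMatrixOne (hp : ∀ i, (p i).Prime) (hodd : ∀ i, Odd (p i))
    (hinj : Function.Injective p) (h4 : (∏ i, p i) % 4 = 1) :
    Nat.card ((congruentNumberCurve (∏ i, p i)).selmerGroup 2) =
      2 ^ (2 + (2 * k -
      (Matrix.fromBlocks (legendreMatrix p + (legendreMatrix p)ᵀ) (legendreMatrix p)ᵀ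
        (legendreMatrix p) (legendreDiagonal p 2)).rank)) := by
  rw [monsky_card_selmerGroup_two_odd_holds k p hp hodd hinj,
    monskySelmerRankOdd_eq_sub_rank_smithMatrixOne p hp hodd hinj h4]

/-- **`#Sel⁽²⁾(E⁽ⁿ⁾/ℚ) = 4 ⟺ det M₁ = 1`** for `n = p₁⋯p_k ≡ 1 (mod 4)` ("`Sel⁽²⁾(E)` is generated by the
image of `E(ℚ)[2]`", i.e. has rank two, iff `crnk M₁ = 0`), unconditionally.
[cite: Smith2016CongruentDensity, §1 Conj. 1.1 / Thm. 1.2 (chunk p0003 L9–L31) and §2 (chunk p0005 L65–L75)]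
[cite: HeathBrown1994SelmerCongruentII, Appendix (Monsky), typescript p. 39 L10–L33] -/
theorem card_selmerGroup_two_eq_four_iff_det_smithMatrixOne (hp : ∀ i, (p i).Prime)
    (hodd : ∀ i, Odd (p i)) (hinj : Function.Injective p) (h4 : (∏ i, p i) % 4 = 1) :
    Nat.card ((congruentNumberCurve (∏ i, p i)).selmerGroup 2) = 4 ↔
      (Matrix.fromBlocks (legendreMatrix p + (legendreMatrix p)ᵀ) (legendreMatrix p)ᵀ
        (legendreMatrix p) (legendreDiagonal p 2)).det = 1 := by
  rw [card_selmerGroup_two_eq_pow_smithMatrixOne p hp hodd hinj h4,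
    ← monskySelmerRankOdd_eq_zero_iff_det_smithMatrixOne p hp hodd hinj h4,
    monskySelmerRankOdd_eq_sub_rank_smithMatrixOne p hp hodd hinj h4,
    show (4 : ℕ) = 2 ^ 2 by norm_num]
  constructor
  · intro h
    have := Nat.pow_right_injective le_rfl h
    omega
  · intro h
    rw [h]

/-! ### The descent count read backwards: rank `0` and `Ш[2^∞] = 0` give `#Sel₂ = 4` -/

/-- In an abelian group whose `2`-primary component is trivial, an element killed by `2` is zero.
[cite: SilvermanAEC2009, Thm. X.4.2 (the groups Ш[m])] -/
theorem eq_zero_of_two_nsmul_eq_zero_of_primaryComponent_eq_bot {G : Type*} [AddCommGroup G]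
    (hbot : AddCommGroup.primaryComponent G 2 = ⊥) {y : G} (hy : 2 • y = 0) : y = 0 := by
  have hmem : y ∈ AddCommGroup.primaryComponent G 2 := by
    rw [AddCommGroup.mem_primaryComponent]
    exact ⟨1, by rw [pow_one]; exact hy⟩
  rw [hbot, AddSubgroup.mem_bot] at hmem
  exact hmem

/-- **`rank E_N(ℚ) = 0` and `Ш(E_N/ℚ)[2^∞] = 0` ⟹ `#Sel⁽²⁾(E_N/ℚ) = 4`** (any `N ≠ 0`): the exact descent
count `#Sel₂ = 2^{rk} · #E(ℚ)[2] · #(Ш ⊓ H¹[2])` (Silverman X.4.2, tree `natCard_selmerGroup_eq`) with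
`#E_N(ℚ)[2] = 4` and `Ш ⊓ H¹[2] = 0`. [cite: SilvermanAEC2009, Thm. X.4.2]
[cite: Smith2016CongruentDensity, §1 Conj. 1.1 (chunk p0003 L9–L13: the exact sequence)] -/
theorem card_selmerGroup_two_eq_four_of_mordellWeilRank_eq_zero_of_sha {N : ℕ} (hN : N ≠ 0)
    (hr : haveI := isElliptic_congruentNumberCurve hN; (congruentNumberCurve N).mordellWeilRank = 0)
    (hsha : haveI := isElliptic_congruentNumberCurve hN;
      AddCommGroup.primaryComponent (congruentNumberCurve N).sha 2 = ⊥) :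
    Nat.card ((congruentNumberCurve N).selmerGroup 2) = 4 := by
  haveI := isElliptic_congruentNumberCurve hN
  have hcard := (congruentNumberCurve N).natCard_selmerGroup_eq (n := 2) two_ne_zero
  -- `Ш ⊓ H¹[2]` is trivial: its elements are `2`-torsion elements of `Ш`
  have hbot : (congruentNumberCurve N).sha ⊓
      AddSubgroup.torsionBy (congruentNumberCurve N).galH1 ((2 : ℕ) : ℤ) = ⊥ := by
    rw [eq_bot_iff]
    intro x hx
    rw [AddSubgroup.mem_bot]
    obtain ⟨hxs, hxt⟩ := AddSubgroup.mem_inf.mp hx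
    have h2 : (2 : ℕ) • (⟨x, hxs⟩ : (congruentNumberCurve N).sha) = 0 := by
      apply Subtype.ext
      rw [AddSubgroupClass.coe_nsmul, ZeroMemClass.coe_zero]
      have := AddSubgroup.torsionBy.nsmul_iff.mp
        (show x ∈ AddSubgroup.torsionBy (congruentNumberCurve N).galH1 ((2 : ℕ) : ℤ) from hxt)
      simpa using this
    have := eq_zero_of_two_nsmul_eq_zero_of_primaryComponent_eq_bot hsha h2
    exact congr_arg Subtype.val this
  have hone : Nat.card ((congruentNumberCurve N).sha ⊓
      AddSubgroup.torsionBy (congruentNumberCurve N).galH1 ((2 : ℕ) : ℤ) :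
        AddSubgroup (congruentNumberCurve N).galH1) = 1 := by
    rw [hbot]; exact AddSubgroup.card_bot
  rw [hr, pow_zero, one_mul] at hcard
  -- `#E_N(ℚ)[2] = 4`; the generic count carries the classical `DecidableEq` inside `E(ℚ)`, bridged by
  -- `convert` (a subsingleton)
  have aux : ∀ {C T S : ℕ}, C = T * S → T = 4 → S = 1 → C = 4 := by
    intro C T S hC hT hS; subst hT; subst hS; simpa using hC
  have key := aux hcard (by convert natCard_torsionBy_two_congruentNumberCurve hN; norm_num) hone
  simpa only [Nat.cast_ofNat] using key

/-- **`#Sel⁽²⁾(E_N/ℚ) = 4 ⟺ rank E_N(ℚ) = 0 ∧ Ш(E_N/ℚ)[2^∞] = 0`** for every `N ≠ 0`: the two sides of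
Smith's Conjecture 1.1 / of TYZ (journal) Thm. 1.2 that concern the curve agree
(`⟹`: the tree's `Smith2016.mordellWeilRank_eq_zero_of_card_selmerGroup_two`,
`primaryComponent_sha_two_eq_bot_of_card_selmerGroup_two`; `⟸`: the descent count above).
[cite: Smith2016CongruentDensity, §1 Conj. 1.1 / Cor. 1.3 (chunk p0003 L9–L13, L39–L44)]
[cite: TianYuanZhang2017, Thm. 1.2 (journal numbering)] [cite: SilvermanAEC2009, Thm. X.4.2] -/
theorem card_selmerGroup_two_eq_four_iff_rank_zero_and_sha {N : ℕ} (hN : N ≠ 0) :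
    Nat.card ((congruentNumberCurve N).selmerGroup 2) = 4 ↔
      (haveI := isElliptic_congruentNumberCurve hN; (congruentNumberCurve N).mordellWeilRank = 0) ∧
      (haveI := isElliptic_congruentNumberCurve hN;
        AddCommGroup.primaryComponent (congruentNumberCurve N).sha 2 = ⊥) :=
  ⟨fun h => ⟨mordellWeilRank_eq_zero_of_card_selmerGroup_two hN h,
    primaryComponent_sha_two_eq_bot_of_card_selmerGroup_two hN h⟩,
    fun h => card_selmerGroup_two_eq_four_of_mordellWeilRank_eq_zero_of_sha hN h.1 h.2⟩

/-- **`rank E⁽ⁿ⁾(ℚ) = 0 ∧ Ш(E⁽ⁿ⁾/ℚ)[2^∞] = 0 ⟺ det M₁ = 1`** for `n = p₁⋯p_k ≡ 1 (mod 4)`, every `k`,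
unconditionally: the curve side of TYZ (journal) Thm. 1.2 / Smith Thm. 1.2 in decidable shape.
[cite: Smith2016CongruentDensity, §1 Thm. 1.2 (chunk p0003 L29–L31) and §2 (chunk p0005 L65–L75)]
[cite: TianYuanZhang2017, Thm. 1.2 (journal numbering)]
[cite: HeathBrown1994SelmerCongruentII, Appendix (Monsky), typescript p. 39 L10–L33, p. 40 L1–L24] -/
theorem rank_zero_and_sha_iff_det_smithMatrixOne (hp : ∀ i, (p i).Prime) (hodd : ∀ i, Odd (p i))
    (hinj : Function.Injective p) (h4 : (∏ i, p i) % 4 = 1) :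
    ((haveI := isElliptic_congruentNumberCurve (Squarefree.ne_zero (squarefree_prod_of_injective p hp hinj));
        (congruentNumberCurve (∏ i, p i)).mordellWeilRank = 0) ∧
      (haveI := isElliptic_congruentNumberCurve (Squarefree.ne_zero (squarefree_prod_of_injective p hp hinj));
        AddCommGroup.primaryComponent (congruentNumberCurve (∏ i, p i)).sha 2 = ⊥)) ↔

      (Matrix.fromBlocks (legendreMatrix p + (legendreMatrix p)ᵀ) (legendreMatrix p)ᵀ
        (legendreMatrix p) (legendreDiagonal p 2)).det = 1 := by
  rw [← card_selmerGroup_two_eq_four_iff_rank_zero_and_sha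
      (Squarefree.ne_zero (squarefree_prod_of_injective p hp hinj)),
    card_selmerGroup_two_eq_four_iff_det_smithMatrixOne p hp hodd hinj h4]

/-- `N`-form of `card_selmerGroup_two_eq_four_iff_det_smithMatrixOne` (`∏ pᵢ = N`).
[cite: Smith2016CongruentDensity, §2 proof of Thm. 1.2 (chunk p0005 L65–L75)] -/
theorem card_selmerGroup_two_eq_four_iff_det_smithMatrixOne' {N : ℕ} (hn : ∏ i, p i = N)
    (hp : ∀ i, (p i).Prime) (hodd : ∀ i, Odd (p i)) (hinj : Function.Injective p) (h4 : N % 4 = 1) :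
    Nat.card ((congruentNumberCurve N).selmerGroup 2) = 4 ↔
      (Matrix.fromBlocks (legendreMatrix p + (legendreMatrix p)ᵀ) (legendreMatrix p)ᵀ
        (legendreMatrix p) (legendreDiagonal p 2)).det = 1 := by
  subst hn
  exact card_selmerGroup_two_eq_four_iff_det_smithMatrixOne p hp hodd hinj h4

end Selmer

end Literature.NumberTheory.EllipticCurves.Smith2016
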